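/-
Copyright (c) 2026 the pub-hodgecm-mathlib formalisation cell (harness21).  Prover seat hodgecm-mathlib-LH4-p14 (g4): Track A «(D-RAM) FOUR-FRAME» squad of crux H413, unit U2H (ii-H),
(ρ2b′-X) payer of record (heir) — HEAD-OF-ORGANS PRELUDE: the three letter-level seams S0 ∕ S1 ∕ S4 of the payer's MAP v1 104f31d9 that need no organ, 2026-09-04.
-/
import Summits.HodgeConjecture.HodgeConjecture.Theorems.F0P3cDyRamFixedPointCensusTypeTwoLattice   -- ★ p857061 (p14 lineage): brings every token of :418 (`IsVertexLattice`, `mapGL`, `placeForm`, `localNonsplitEquiv`, …)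
import Literature.NumberTheory.Automorphic.UnitaryGroupIntegralPointsReductionRamified             -- ★ `natCard_residueField_eq_of_ramified` (`|𝓀[E_w]| = q_v` at a ramified non-split place, 2-free)
import Literature.NumberTheory.Automorphic.RamifiedPlaceAntiFixedUniformizer                       -- ★ `valued_toPlace_uniformizer_of_ramified` (`v_w(ι_w π_v) = exp(−2)`, 2-free)
import HarnessLib

/-!
# F0 · P3c · line LH4 «(D-RAM) FOUR-FRAME» — unit (ii-H), leaf (ρ2b′-X): HEAD-OF-ORGANS PRELUDE (seams S0, S1, S4 of the payer's MAP — no organ needed)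
(Neukirch 1999 Ch. II §4; Serre 1979 Ch. III §6; Rogawski 1990 §1.9, §4.9)

Cell `pub/hodgecm-mathlib`, crux H413 = `stmt-HodgeConjecture-24833` (helper lane, count-neutral); THEOREMS ONLY (no definition, no instance, no notation, no named fact, no `sorry`,
default heartbeats), typed under the LINE FILE's scopes.  Socket served: the head `hOrgNV_of_organs_tE2` of the (ρ2b′-X) assembly (payer MAP v1 `F0/P3c/LH4/LH4-p14/g4/HEAD-OF-ORGANS-MAP
.v1.LH4p14g4.md` 104f31d9), whose conclusion is the clause of `hOrgNV` (★ p857374 `…SignedCensusNV.latticeCensus_literals_of_signedCensusNV`) at one place.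

WHAT IS PROVED (letter-level bookkeeping in the EXACT tokens of `hOrgNV`'s clause; no census mathematics):
* §1 (seam S0) `natCard_quot_eq_card_residueField`: at a place `w ∣ v` of the CM field `L` fixed by complex conjugation and RAMIFIED over `L⁺`, `Nat.card (𝓞 L⁺ ⧸ v) =
  Fintype.card 𝓀(L_w)` — the first conjunct `q_v = q_w` of `hOrgNV`'s clause, token for token (★ `natCard_residueField_eq_of_ramified`: `f(w|v) = 1`, + ★
  `natCard_residueField_eq_of_compatible`; 2-free).
* §2 (seam S1) `eq_of_valued_eq_toPlace_uniformizer_pow`: the `m`-TOKEN of :418 is UNIQUE — `v_w(x) = v_w(ι_w(π_v)^m) = v_w(ι_w(π_v)^{m′}) ⇒ m = m′` (★ `valued_toPlace_uniformizer_of_ramified`: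
  `v_w(ι_w π_v) = exp(−2)`), so the head may set `mm :=` any exponent it computes and discharge `m = mm` from the token hypothesis; and `valued_toPlace_uniformizer_pow`, the value
  `v_w(ι_w(π_v)^m) = exp(−2m)` it rests on.
* §3 (seam S4) THE HYPERBOLIC LITERAL'S FRAME IS THE FIBRATION'S BLOCK FORM ON THE NOSE: `(StdForm.antidiagonal 3).over K = !![H₂ 0 0, 0, H₂ 0 1; 0, 1, 0; H₂ 1 0, 0, H₂ 1 1]` with
  `H₂ := (StdForm.antidiagonal 2).over K` (`antidiagonal_three_over_eq_block_antidiagonal_two`), hence — `IsSelfDualLattice` being `IsVertexLattice … 0` by `abbrev` and `placeForm Φ₂ w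
  = (StdForm.antidiagonal 2).over L_w` (★ `placeForm_antidiagOne`) — the count `N(t)` of `hOrgNV`'s [G-side] is LITERALLY the fixed self-dual family of ★ p857312 §2
  `ncard_fixed_selfDual_eq_ncard_axis_add_sum_finsum_ncard_glueFibre` for the block form `(H₂, h) := (placeForm Φ₂ w, 1)` in which `ι_w(γ_H.1)` is unitary
  (`setOf_typeZero_fixed_eq_setOf_isSelfDualLattice_block`): for the hyperbolic literal `ι_w(t_h) = endoGL (ι_w(γ_H.1), ι_w(γ_H.2))` (★ `exists_isLocalNormPair_coe_eq_of_frame` with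
  `A := 1`) no frame change and no evenness adapter is needed.

HONEST LABEL: HC_CM is proved only modulo the 7 printed citations (2 remaining named inputs: hLiu418 = stmt-HodgeConjecture-24832, h413 = stmt-HodgeConjecture-24833) until rung 0
closes; count-neutral letter bookkeeping — (ρ2b′-X) is OPEN at every `tE` ((R-25): `tE = 2` organ road of record, `tE ≠ 2` open).

## References
* [NeukirchANT1999] J. Neukirch, *Algebraic Number Theory*, Springer GMW 322 (1999), Ch. I §8 Prop. (8.2); Ch. II §4 Prop. (4.3).
* [Serre1979] J.-P. Serre, *Local Fields*, GTM 67 (1979), Ch. III §6.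
* [Rogawski1990] J. D. Rogawski, *Automorphic Representations of Unitary Groups in Three Variables*, Ann. of Math. Stud. 123 (1990), §1.9 p. 8; §4.3 p. 43; §4.9 Prop. 4.9.1 (b) p. 55.
* [Kottwitz1986BaseChangeUnits] R. E. Kottwitz, *Base change for unit elements of Hecke algebras*, Compositio Math. 60 (1986), §1 pp. 240–241.
-/

set_option autoImplicit false

noncomputable section

namespace Summit.HodgeConjecture.HodgeConjecture.Cruxes.H413.F0P3cDyRamFixedPointCensusTypeTwoPrelude

-- THE LINES MODULE'S `open` CONTEXT (tree `Cruxes/H413/Lines/F0_P3c_DyRamFourFrame_U2H_HSide.lean`, after its `namespace`):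
open MeasureTheory Measure NumberField IsDedekindDomain Topology Filter
open Literature.NumberTheory.Automorphic Literature.NumberTheory.Automorphic.UnitaryGroup Literature.NumberTheory.Automorphic.IntegralReduction
open Literature.NumberTheory.Rogawski1990 Literature.NumberTheory.GaloisRepresentations
open Literature.NumberTheory.Automorphic.UnitaryThreeFourFrame
open Summit.HodgeConjecture.HodgeConjecture.Cruxes.H413.F0P3cDyRamFourFrameHSideDefs
open Summit.HodgeConjecture.HodgeConjecture.Cruxes.H413.F0P3cDyRamFourFrameHFamilyDefs
open scoped Matrix MatrixGroups Classical ValuativeRel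
open Summit.HodgeConjecture.HodgeConjecture.Cruxes.H413.F0P3cDyRamFourFrameHSideDefsR
open Summit.HodgeConjecture.HodgeConjecture.Cruxes.H413.F0P3cDyRamFourFrameLawDefsR (shiftT shiftR)
open Literature.NumberTheory.Automorphic.UnitaryLatticeTree Literature.NumberTheory.Automorphic.HermitianLattice

/-! ## §1 Seam S0: `q_v = q_w` at a ramified place, in `hOrgNV`'s letters -/

/-- **`q_v = q_w`** — the first conjunct of `hOrgNV`'s clause, token for token: at a place `w ∣ v` of `L` fixed by complex conjugation with `e(w|v) ≠ 1`,
`Nat.card (𝓞 L⁺ ⧸ v) = Fintype.card 𝓀(L_w)` (`f(w|v) = 1`). [cite: NeukirchANT1999, Ch. I §8 Prop. (8.2); Ch. II §4 Prop. (4.3)] -/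
theorem natCard_quot_eq_card_residueField (L : Type) [Field L] [NumberField L] [IsCMField L]
    {v : HeightOneSpectrum (𝓞 ↥(maximalRealSubfield L))} (w : UnitaryGroup.PlacesOver L v)
    (hw : IsCMField.complexConj L • w.1 = w.1) (he : v.asIdeal.ramificationIdx' w.1.asIdeal ≠ 1)
    [Fintype (Valued.ResidueField (w.1.adicCompletion L))] :
    (Nat.card (𝓞 ↥(maximalRealSubfield L) ⧸ v.asIdeal)) = (Fintype.card (Valued.ResidueField (w.1.adicCompletion L))) := by
  haveI : Algebra.IsQuadraticExtension ↥(maximalRealSubfield L) L := IsCMField.isQuadraticExtension L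
  rw [Fintype.card_eq_nat_card, ← natCard_residueField_eq_of_compatible,
    natCard_residueField_eq_of_ramified (IsCMField.complexConj L) v (IsCMField.complexConj_ne_one L) w hw he]

/-! ## §2 Seam S1: the `m`-token of :418 is unique -/

/-- **`v_w(ι_w(π_v)^m) = exp(−2m)`** at a ramified non-split place (`v_w(ι_w π_v) = exp(−2)`, ★ `valued_toPlace_uniformizer_of_ramified`). [cite: Serre1979, Ch. III §6] -/
theorem valued_toPlace_uniformizer_pow (L : Type) [Field L] [NumberField L] [IsCMField L]
    {v : HeightOneSpectrum (𝓞 ↥(maximalRealSubfield L))} (w : UnitaryGroup.PlacesOver L v)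
    (hw : IsCMField.complexConj L • w.1 = w.1) (he : v.asIdeal.ramificationIdx' w.1.asIdeal ≠ 1) (m : ℕ) :
    Valued.v ((toPlace v w (HeckeCharacter.uniformizer ↥(maximalRealSubfield L) v : v.adicCompletion ↥(maximalRealSubfield L))) ^ m) =
      WithZero.exp (-(2 * (m : ℤ))) := by
  haveI : Algebra.IsQuadraticExtension ↥(maximalRealSubfield L) L := IsCMField.isQuadraticExtension L
  obtain ⟨hval, -⟩ := valued_toPlace_uniformizer_of_ramified L (IsCMField.complexConj L) (IsCMField.complexConj_ne_one L) w hw he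
  rw [map_pow, hval, ← WithZero.exp_nsmul]
  congr 1
  simp [mul_comm]

/-- **THE `m`-TOKEN IS UNIQUE**: `v_w(x) = v_w(ι_w(π_v)^m)` and `v_w(x) = v_w(ι_w(π_v)^{m′})` force `m = m′` — so the head-of-organs may name the depth it computes `mm` and
discharge :418's `m = mm` from the token hypothesis. [cite: Serre1979, Ch. III §6] [cite: Rogawski1990, §4.9 Prop. 4.9.1 (b) p. 55] -/
theorem eq_of_valued_eq_toPlace_uniformizer_pow (L : Type) [Field L] [NumberField L] [IsCMField L]
    {v : HeightOneSpectrum (𝓞 ↥(maximalRealSubfield L))} (w : UnitaryGroup.PlacesOver L v)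
    (hw : IsCMField.complexConj L • w.1 = w.1) (he : v.asIdeal.ramificationIdx' w.1.asIdeal ≠ 1)
    {x : w.1.adicCompletion L} {m m' : ℕ}
    (h : Valued.v x = Valued.v ((toPlace v w (HeckeCharacter.uniformizer ↥(maximalRealSubfield L) v : v.adicCompletion ↥(maximalRealSubfield L))) ^ m))
    (h' : Valued.v x = Valued.v ((toPlace v w (HeckeCharacter.uniformizer ↥(maximalRealSubfield L) v : v.adicCompletion ↥(maximalRealSubfield L))) ^ m')) :
    m = m' := by
  rw [h, valued_toPlace_uniformizer_pow L w hw he, valued_toPlace_uniformizer_pow L w hw he] at h'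
  have h2 := WithZero.exp_injective h'
  omega

/-! ## §3 Seam S4: the hyperbolic literal's frame is the fibration's block form on the nose -/

/-- **`Φ₃ = block(Φ₂, 1)` AS MATRICES**: `(StdForm.antidiagonal 3).over K = !![H₂ 0 0, 0, H₂ 0 1; 0, 1, 0; H₂ 1 0, 0, H₂ 1 1]` with `H₂ := (StdForm.antidiagonal 2).over K` — the block
shape of ★ `UnitaryLatticeTreeBlockGlueFibration` (`W = ⟨e₀, e₂⟩` hyperbolic with form `Φ₂`, axis `e₁` of length `1`). [cite: Rogawski1990, §1.9 p. 8] -/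
theorem antidiagonal_three_over_eq_block_antidiagonal_two (K : Type*) [Field K] :
    (StdForm.antidiagonal 3).over K =
      !![((StdForm.antidiagonal 2).over K) 0 0, 0, ((StdForm.antidiagonal 2).over K) 0 1; 0, (1 : K), 0;
        ((StdForm.antidiagonal 2).over K) 1 0, 0, ((StdForm.antidiagonal 2).over K) 1 1] := by
  ext i j
  fin_cases i <;> fin_cases j <;> simp [StdForm.over, StdForm.antidiagonal_J_apply, Fin.rev]

/-- **THE [G-SIDE] COUNT OF `hOrgNV` IS THE FIBRATION'S FIXED SELF-DUAL FAMILY, ON THE NOSE**: for ANY `Γ : GL₃(L_w)`,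
`{M | IsVertexLattice σ_w ϖ ((StdForm.antidiagonal 3).over L_w) 0 M ∧ Γ·M = M} = {M | IsSelfDualLattice σ_w ϖ !![H₂ 0 0, 0, H₂ 0 1; 0, 1, 0; H₂ 1 0, 0, H₂ 1 1] M ∧ Γ·M = M}` with
`H₂ := placeForm Φ₂ w` — the local form in which `ι_w(γ_H.1)` is unitary (★ `placeForm_antidiagOne` + `antidiagonal_three_over_eq_block_antidiagonal_two`; `IsSelfDualLattice` is
`IsVertexLattice … 0` by `abbrev`).  So for the hyperbolic literal `Γ = ι_w(t_h) = endoGL (ι_w(γ_H.1), ι_w(γ_H.2))` ★ p857312 §2 applies with `(H₂, h) := (placeForm Φ₂ w, 1)` verbatim.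
[cite: Rogawski1990, §4.3 p. 43; §4.9 Prop. 4.9.1 (b) p. 55] [cite: Kottwitz1986BaseChangeUnits, §1 pp. 240–241] -/
theorem setOf_typeZero_fixed_eq_setOf_isSelfDualLattice_block (L : Type) [Field L] [NumberField L] [IsCMField L]
    {v : HeightOneSpectrum (𝓞 ↥(maximalRealSubfield L))} (w : UnitaryGroup.PlacesOver L v)
    (hw : IsCMField.complexConj L • w.1 = w.1) (ϖ : w.1.adicCompletion L) (Γ : GL (Fin 3) (w.1.adicCompletion L)) :
    {M : Submodule (Valued.integer (w.1.adicCompletion L)) (Fin 3 → (w.1.adicCompletion L)) |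
        IsVertexLattice (galAdicCompletionMap (L := L) (IsCMField.complexConj L) hw) ϖ ((StdForm.antidiagonal 3).over (w.1.adicCompletion L)) 0 M ∧ mapGL Γ M = M} =
      {M : Submodule (Valued.integer (w.1.adicCompletion L)) (Fin 3 → (w.1.adicCompletion L)) |
        IsSelfDualLattice (galAdicCompletionMap (L := L) (IsCMField.complexConj L) hw) ϖ
          (!![(placeForm (Matrix.of fun i j : Fin 2 => if i.val + j.val + 1 = 2 then (1 : L) else 0) w.1) 0 0, 0,
              (placeForm (Matrix.of fun i j : Fin 2 => if i.val + j.val + 1 = 2 then (1 : L) else 0) w.1) 0 1;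
             0, (1 : w.1.adicCompletion L), 0;
             (placeForm (Matrix.of fun i j : Fin 2 => if i.val + j.val + 1 = 2 then (1 : L) else 0) w.1) 1 0, 0,
              (placeForm (Matrix.of fun i j : Fin 2 => if i.val + j.val + 1 = 2 then (1 : L) else 0) w.1) 1 1] : Matrix (Fin 3) (Fin 3) (w.1.adicCompletion L)) M ∧
        mapGL Γ M = M} := by
  rw [placeForm_antidiagOne, ← antidiagonal_three_over_eq_block_antidiagonal_two]

end Summit.HodgeConjecture.HodgeConjecture.Cruxes.H413.F0P3cDyRamFixedPointCensusTypeTwoPrelude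

end
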